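import Summits.AtomisticToContinuum.Crystallization.Theorems.ChartedZeroExcessLayeredLatticeLiouvilleZZZYRCP
import Literature.Probability.Percolation.CrossingClusterSecondMoment

/-!
# Charted zero-excess layered-lattice Liouville — ZZZYRCQ: TYPE-RESOLVED routing multiplicity (king remainder ÷ 18)

Cell `decomp-a2c`, lens 2, generation 99.  ZZZYRCP counts the pairs of king length `n` routed through a fixed range pair `y` by the injection
`x ↦ (Δ, position)` into `shell n × [0, n)` (`≤ n (24n² + 2)`).  But a pair routed through `y` at position `i` has its `i`-th STEP TYPE equal to
`y.2 − y.1`; for a `Δ`-rule the step type is a function `stepType Δ i`, so the injection lands in the FIBRE `{(Δ, i) : stepType Δ i = y.2 − y.1}`: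

* ★ `card_routing_le_typed` — the typed injection for any path system equivariant under a subgroup `H` of index translations whose steps on the
  family are given by a `stepType (x.2 − x.1) i`: `#Y ≤ #{(Δ, i) ∈ S × [0,n) : stepType Δ i = y.2 − y.1}`.
* ★ `king_typed_count` — for the king system the fibre over a type `s` inside `shell n × [0, n)` has at most `2n(n+1)(2n+1)/3 ≈ (4/3) n³` elements
  (vs. `24 n³`): pin the coordinate where `|Δ_c| = n` (it moves, so `Δ_c = s_c n`), every other coordinate lies in `[-i, i]` if `s_c = 0` (it has
  stopped) or in a signed half-range of `n − i` values if `s_c ≠ 0` (still moving); sum over `i < n` with `Σ (2i+1)² = n(4n²−1)/3`,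
  `Σ (2i+1)(n−i) = Σ (n−i)² = n(n+1)(2n+1)/6`.
* ★ `king_multiplicity_typed`, ★★ `schemeDominatedOnP_remainder_king_typed` — the remainder lemma for king paths with `M n = 2n(n+1)(2n+1)/3`:
  `θ(D) = Σ_{n ≥ nD} M n · 7n / max(D, c₀ n)⁸`, `nD = ⌊D/ϱ⌋ + 1`; numerically (ϱ 4, c₀ 0.74 | 0.80): `θ(17) = 4.9e-3 | 3.3e-3`,
  `θ(24) = 1.7e-3 | 1.2e-3`, `θ(32) = 7.1e-4 | 4.8e-4`, `θ(48) = 2.1e-4 | 1.4e-4`, `θ(64) = 8.7e-5 | 5.9e-5` (R-table × (1+α), N-table × (1+α⁻¹));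
  memo NODE-g99 §8.6.

Theorem file (6 defs `kstep` `V` `A0` `A1` `A2` `bfac`, 19 theorems); imports ZZZYRCP; no instance / notation / option; 0 sorry. [g99]
-/

open scoped BigOperators

namespace Summit.AtomisticToContinuum.Crystallization.Theorems.ChartedZeroExcessLayeredLatticeLiouville

open Summit.AtomisticToContinuum.Crystallization.Theorems.ChartedPlanarOrderRigidityDoor (E3)

/-! ### §1 The typed injection -/

/-- ★ **TYPED ROUTING MULTIPLICITY**: as `card_routing_le_of_equivariant`, but the injection `x ↦ (x.2 − x.1, first position at y)` lands in the
fibre of the step-type function over `y.2 − y.1`. [g99] -/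
theorem card_routing_le_typed {z : (Cell 2 × ℤ) × (Cell 2 × ℤ) → ℕ → Cell 2 × ℤ} (H : AddSubgroup (Cell 2 × ℤ))
    (hequi : ∀ (x : (Cell 2 × ℤ) × (Cell 2 × ℤ)) (t : Cell 2 × ℤ), t ∈ H → ∀ i : ℕ, z (x.1 + t, x.2 + t) i = z x i + t)
    {n : ℕ} {y : (Cell 2 × ℤ) × (Cell 2 × ℤ)} (S : Finset (Cell 2 × ℤ)) (Y : Finset ((Cell 2 × ℤ) × (Cell 2 × ℤ)))
    (hcos : ∀ x ∈ Y, ∀ x' ∈ Y, x'.1 - x.1 ∈ H) (stepType : (Cell 2 × ℤ) → ℕ → Cell 2 × ℤ)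
    (hstep : ∀ x ∈ Y, ∀ i : ℕ, z x (i + 1) - z x i = stepType (x.2 - x.1) i)
    (hY : ∀ x ∈ Y, x.2 - x.1 ∈ S ∧ ∃ i < n, piece z x i = y) :
    Y.card ≤ ((S ×ˢ Finset.range n).filter (fun p => stepType p.1 p.2 = y.2 - y.1)).card := by
  classical
  let pos : (Cell 2 × ℤ) × (Cell 2 × ℤ) → ℕ := fun x => if h : ∃ i, i < n ∧ piece z x i = y then Nat.find h else 0
  have hpos : ∀ x ∈ Y, pos x < n ∧ piece z x (pos x) = y := by
    intro x hx
    obtain ⟨-, i, hi, hy⟩ := hY x hx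
    have h : ∃ i, i < n ∧ piece z x i = y := ⟨i, hi, hy⟩
    have hp : pos x = Nat.find h := by simp only [pos, dif_pos h]
    rw [hp]
    exact Nat.find_spec h
  have hmaps : Set.MapsTo (fun x => (x.2 - x.1, pos x)) (Y : Set ((Cell 2 × ℤ) × (Cell 2 × ℤ)))
      (((S ×ˢ Finset.range n).filter (fun p => stepType p.1 p.2 = y.2 - y.1) : Finset ((Cell 2 × ℤ) × ℕ)) :
        Set ((Cell 2 × ℤ) × ℕ)) := fun x hx => by
    refine Finset.mem_coe.mpr (Finset.mem_filter.mpr ⟨Finset.mem_product.mpr ⟨(hY x hx).1, Finset.mem_range.mpr (hpos x hx).1⟩, ?_⟩)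
    have h := (hpos x hx).2
    show stepType (x.2 - x.1) (pos x) = y.2 - y.1
    rw [← hstep x hx (pos x), ← h]
    rfl
  have hinj : Set.InjOn (fun x => (x.2 - x.1, pos x)) (Y : Set ((Cell 2 × ℤ) × (Cell 2 × ℤ))) := by
    intro x hx x' hx' hxx'
    simp only [Prod.mk.injEq] at hxx'
    obtain ⟨hΔ, hp⟩ := hxx'
    have h1 : z x (pos x) = y.1 := congrArg Prod.fst (hpos x hx).2
    have h2 : z x' (pos x) = y.1 := by rw [hp]; exact congrArg Prod.fst (hpos x' hx').2
    set t := x'.1 - x.1 with ht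
    have htH : t ∈ H := hcos x hx x' hx'
    have hx'eq : x' = (x.1 + t, x.2 + t) := by
      refine Prod.ext ?_ ?_
      · show x'.1 = x.1 + t
        rw [ht, add_sub_cancel]
      · show x'.2 = x.2 + t
        have e : x'.2 = x'.2 - x'.1 + x'.1 := (sub_add_cancel _ _).symm
        rw [e, ← hΔ, ht]; abel
    have h3 := hequi x t htH (pos x)
    rw [← hx'eq, h2, h1] at h3
    have ht0 : t = 0 := by
      have := congrArg (fun u => u - y.1) h3
      simpa using this.symm
    rw [hx'eq, ht0, add_zero, add_zero]
  exact Finset.card_le_card_of_injOn _ hmaps hinj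

/-! ### §2 King step types and the coordinate ranges -/

/-- the `i`-th king step type of the difference `Δ`. [g99] -/
def kstep (Δ : Cell 2 × ℤ) (i : ℕ) : Cell 2 × ℤ := kvec Δ (i + 1) - kvec Δ i

/-- components of the king step. [g99] -/
theorem kstep_apply (Δ : Cell 2 × ℤ) (i : ℕ) :
    (∀ k, (kstep Δ i).1 k = kpos (Δ.1 k) (i + 1) - kpos (Δ.1 k) i) ∧ (kstep Δ i).2 = kpos Δ.2 (i + 1) - kpos Δ.2 i :=
  ⟨fun _ => rfl, rfl⟩

/-- the king steps of a pair are the step types of its difference. [g99] -/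
theorem kingZ_succ_sub_eq_kstep (x : (Cell 2 × ℤ) × (Cell 2 × ℤ)) (i : ℕ) : kingZ x (i + 1) - kingZ x i = kstep (x.2 - x.1) i := by
  unfold kingZ kstep
  exact add_sub_add_left_eq_sub _ _ _

/-- the admissible range of a NON-pinned coordinate `d` with `|d| ≤ n` whose `i`-th step is `t`: `[-i, i]` if `t = 0` (stopped),
`(i, n]` if `t > 0`, `[-n, -i)` if `t < 0` (still moving). [g99] -/
noncomputable def V (n : ℕ) (t : ℤ) (i : ℕ) : Finset ℤ :=
  if t = 0 then Finset.Icc (-(i : ℤ)) i else if 0 < t then Finset.Ioc (i : ℤ) n else Finset.Ico (-(n : ℤ)) (-(i : ℤ))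

/-- `#V = 2i+1` for a stopped coordinate. [g99] -/
theorem card_V_zero (n i : ℕ) : (V n 0 i).card = 2 * i + 1 := by
  simp only [V, if_true, Int.card_Icc]
  omega

/-- `#V = n − i` for a moving coordinate. [g99] -/
theorem card_V_ne {t : ℤ} (ht : t ≠ 0) (n i : ℕ) : (V n t i).card = n - i := by
  unfold V
  rw [if_neg ht]
  split_ifs
  · rw [Int.card_Ioc]; omega
  · rw [Int.card_Ico]; omega

/-- a coordinate with `|d| ≤ n` lies in the range of its own step. [g99] -/
theorem mem_V (n i : ℕ) {d : ℤ} (hd : d.natAbs ≤ n) : d ∈ V n (kpos d (i + 1) - kpos d i) i := by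
  by_cases h : i < d.natAbs
  · rw [kpos_succ_sub, if_pos h]
    rcases lt_trichotomy d 0 with hn | hz | hp
    · rw [Int.sign_eq_neg_one_of_neg hn, V, if_neg (by norm_num), if_neg (by norm_num), Finset.mem_Ico]
      omega
    · subst hz; simp at h
    · rw [Int.sign_eq_one_of_pos hp, V, if_neg (by norm_num), if_pos (by norm_num), Finset.mem_Ioc]
      omega
  · rw [kpos_succ_sub, if_neg h, V, if_pos rfl, Finset.mem_Icc]
    omega

/-- a PINNED coordinate (`|d| = n > i`) equals `(its step) · n`, and its step is non-zero. [g99] -/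
theorem eq_step_mul_of_natAbs_eq {n i : ℕ} {d : ℤ} (hd : d.natAbs = n) (hi : i < n) :
    kpos d (i + 1) - kpos d i ≠ 0 ∧ d = (kpos d (i + 1) - kpos d i) * n := by
  rw [kpos_succ_sub, if_pos (hd ▸ hi)]
  have hd0 : d ≠ 0 := by intro h0; subst h0; simp at hd; omega
  refine ⟨fun h0 => hd0 (Int.sign_eq_zero_iff_zero.mp h0), ?_⟩
  rw [← hd]; exact (Int.sign_mul_natAbs d).symm

/-! ### §3 The cover of the typed fibre and its cardinality -/

/-- cover set, coordinate 0 pinned. [g99] -/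
noncomputable def A0 (n : ℕ) (s : Cell 2 × ℤ) (i : ℕ) : Finset (Cell 2 × ℤ) :=
  if s.1 0 = 0 then ∅ else
    (Fintype.piFinset fun k : Fin 2 => if k = 0 then {s.1 0 * n} else V n (s.1 1) i) ×ˢ V n s.2 i

/-- cover set, coordinate 1 pinned. [g99] -/
noncomputable def A1 (n : ℕ) (s : Cell 2 × ℤ) (i : ℕ) : Finset (Cell 2 × ℤ) :=
  if s.1 1 = 0 then ∅ else
    (Fintype.piFinset fun k : Fin 2 => if k = 0 then V n (s.1 0) i else {s.1 1 * n}) ×ˢ V n s.2 i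

/-- cover set, layer coordinate pinned. [g99] -/
noncomputable def A2 (n : ℕ) (s : Cell 2 × ℤ) (i : ℕ) : Finset (Cell 2 × ℤ) :=
  if s.2 = 0 then ∅ else (Fintype.piFinset fun k : Fin 2 => V n (s.1 k) i) ×ˢ {s.2 * n}

/-- the size of a coordinate range as a real number: `2i+1` (stopped) or `n − i` (moving). [g99] -/
theorem card_V_real (n : ℕ) (t : ℤ) {i : ℕ} (hi : i < n) :
    ((V n t i).card : ℝ) = if t = 0 then 2 * (i : ℝ) + 1 else (n : ℝ) - i := by
  split_ifs with ht
  · rw [ht, card_V_zero]; push_cast; ring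
  · rw [card_V_ne ht, Nat.cast_sub hi.le]

/-- ★ **COVER**: an element `(Δ, i)` of the typed fibre over `s` in `shell n × [0, n)` has `Δ` in one of the three cover sets. [g99] -/
theorem mem_cover_of_kstep_eq {n i : ℕ} {Δ s : Cell 2 × ℤ} (hΔ : Δ ∈ shell n) (hi : i < n) (hs : kstep Δ i = s) :
    Δ ∈ A0 n s i ∪ A1 n s i ∪ A2 n s i := by
  classical
  -- all coordinates are `≤ n` in absolute value and one of them equals `n`
  have hx : ((0 : Cell 2 × ℤ), Δ).2 - ((0 : Cell 2 × ℤ), Δ).1 = Δ := sub_zero Δ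
  have hcube : Δ ∈ cube n := by
    unfold shell at hΔ; split_ifs at hΔ with h0
    · exact cube_mono (Nat.zero_le n) hΔ
    · exact (Finset.mem_sdiff.mp hΔ).1
  have hle : kingN ((0 : Cell 2 × ℤ), Δ) ≤ n := kingN_le_of_sub_mem_cube (hx.symm ▸ hcube)
  have hge : n ≤ kingN ((0 : Cell 2 × ℤ), Δ) := by
    unfold shell at hΔ; split_ifs at hΔ with h0
    · omega
    · have hnot := (Finset.mem_sdiff.mp hΔ).2
      by_contra hlt
      exact hnot (hx ▸ sub_mem_cube_of_kingN_le (x := ((0 : Cell 2 × ℤ), Δ)) (by omega))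
  have hN : kingN ((0 : Cell 2 × ℤ), Δ) = n := le_antisymm hle hge
  simp only [kingN, sub_zero] at hN hle
  have h0le : (Δ.1 0).natAbs ≤ n := (le_max_left _ _).trans ((le_max_left _ _).trans hle)
  have h1le : (Δ.1 1).natAbs ≤ n := (le_max_right _ _).trans ((le_max_left _ _).trans hle)
  have h2le : (Δ.2).natAbs ≤ n := (le_max_right _ _).trans hle
  -- the step components
  obtain ⟨hsf, hss⟩ := kstep_apply Δ i
  have hs0 : kpos (Δ.1 0) (i + 1) - kpos (Δ.1 0) i = s.1 0 := by rw [← hsf 0, hs]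
  have hs1 : kpos (Δ.1 1) (i + 1) - kpos (Δ.1 1) i = s.1 1 := by rw [← hsf 1, hs]
  have hs2 : kpos Δ.2 (i + 1) - kpos Δ.2 i = s.2 := by rw [← hss, hs]
  have hV0 : Δ.1 0 ∈ V n (s.1 0) i := hs0 ▸ mem_V n i h0le
  have hV1 : Δ.1 1 ∈ V n (s.1 1) i := hs1 ▸ mem_V n i h1le
  have hV2 : Δ.2 ∈ V n s.2 i := hs2 ▸ mem_V n i h2le
  have hmax : (Δ.1 0).natAbs = n ∨ (Δ.1 1).natAbs = n ∨ (Δ.2).natAbs = n := by omega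
  rcases hmax with h0 | h1 | h2
  · obtain ⟨hne, heq⟩ := eq_step_mul_of_natAbs_eq h0 hi
    rw [hs0] at hne heq
    refine Finset.mem_union_left _ (Finset.mem_union_left _ ?_)
    rw [A0, if_neg hne, Finset.mem_product, Fintype.mem_piFinset]
    refine ⟨fun k => ?_, hV2⟩
    fin_cases k
    · simpa using heq
    · simpa using hV1
  · obtain ⟨hne, heq⟩ := eq_step_mul_of_natAbs_eq h1 hi
    rw [hs1] at hne heq
    refine Finset.mem_union_left _ (Finset.mem_union_right _ ?_)
    rw [A1, if_neg hne, Finset.mem_product, Fintype.mem_piFinset]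
    refine ⟨fun k => ?_, hV2⟩
    fin_cases k
    · simpa using hV0
    · simpa using heq
  · obtain ⟨hne, heq⟩ := eq_step_mul_of_natAbs_eq h2 hi
    rw [hs2] at hne heq
    refine Finset.mem_union_right _ ?_
    rw [A2, if_neg hne, Finset.mem_product, Fintype.mem_piFinset]
    refine ⟨fun k => ?_, by simpa using heq⟩
    fin_cases k
    · simpa using hV0
    · simpa using hV1

/-- the size of a coordinate range factor. [g99] -/
noncomputable def bfac (n : ℕ) (t : ℤ) (i : ℕ) : ℝ := if t = 0 then 2 * (i : ℝ) + 1 else (n : ℝ) - i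

/-- cardinalities of the three cover sets. [g99] -/
theorem card_cover_le (n : ℕ) (s : Cell 2 × ℤ) {i : ℕ} (hi : i < n) :
    ((A0 n s i ∪ A1 n s i ∪ A2 n s i).card : ℝ) ≤
      (if s.1 0 = 0 then 0 else bfac n (s.1 1) i * bfac n s.2 i) + (if s.1 1 = 0 then 0 else bfac n (s.1 0) i * bfac n s.2 i) +
        (if s.2 = 0 then 0 else bfac n (s.1 0) i * bfac n (s.1 1) i) := by
  classical
  have hV : ∀ t, ((V n t i).card : ℝ) = bfac n t i := fun t => by rw [card_V_real n t hi]; rfl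
  have c0 : ((A0 n s i).card : ℝ) = if s.1 0 = 0 then 0 else bfac n (s.1 1) i * bfac n s.2 i := by
    unfold A0; split_ifs with h
    · simp
    · rw [Finset.card_product, Fintype.card_piFinset, Fin.prod_univ_two]
      simp only [Fin.isValue, ↓reduceIte, Finset.card_singleton, one_ne_zero, one_mul]
      push_cast; rw [hV, hV]
  have c1 : ((A1 n s i).card : ℝ) = if s.1 1 = 0 then 0 else bfac n (s.1 0) i * bfac n s.2 i := by
    unfold A1; split_ifs with h
    · simp
    · rw [Finset.card_product, Fintype.card_piFinset, Fin.prod_univ_two]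
      simp only [Fin.isValue, ↓reduceIte, Finset.card_singleton, one_ne_zero, mul_one]
      push_cast; rw [hV, hV]
  have c2 : ((A2 n s i).card : ℝ) = if s.2 = 0 then 0 else bfac n (s.1 0) i * bfac n (s.1 1) i := by
    unfold A2; split_ifs with h
    · simp
    · rw [Finset.card_product, Fintype.card_piFinset, Fin.prod_univ_two, Finset.card_singleton, mul_one]
      push_cast; rw [hV, hV]
  have hu : ((A0 n s i ∪ A1 n s i ∪ A2 n s i).card : ℝ) ≤ (A0 n s i).card + (A1 n s i).card + (A2 n s i).card := by
    exact_mod_cast (Finset.card_union_le _ _).trans (Nat.add_le_add_right (Finset.card_union_le _ _) _)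
  rw [c0, c1, c2] at hu
  exact hu

/-! ### §4 The three summations -/

/-- `Σ_{i<n} (2i+1)² = n(2n−1)(2n+1)/3`. [g99] -/
theorem sum_odd_sq_eq (n : ℕ) : ∑ i ∈ Finset.range n, (2 * (i : ℝ) + 1) ^ 2 = (n : ℝ) * (2 * n - 1) * (2 * n + 1) / 3 := by
  induction n with
  | zero => simp
  | succ n ih => rw [Finset.sum_range_succ, ih]; push_cast; ring

/-- `Σ_{i<n} (n − i) = n(n+1)/2`. [g99] -/
theorem sum_lin_eq (n : ℕ) : ∑ i ∈ Finset.range n, ((n : ℝ) - i) = (n : ℝ) * (n + 1) / 2 := by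
  induction n with
  | zero => simp
  | succ n ih =>
    rw [Finset.sum_range_succ]
    have e : ∑ i ∈ Finset.range n, (((n + 1 : ℕ) : ℝ) - i) = ∑ i ∈ Finset.range n, (((n : ℝ) - i) + 1) :=
      Finset.sum_congr rfl fun i _ => by push_cast; ring
    rw [e, Finset.sum_add_distrib, ih, Finset.sum_const, Finset.card_range, nsmul_eq_mul]
    push_cast; ring

/-- `Σ_{i<n} (n − i)² = n(n+1)(2n+1)/6`. [g99] -/
theorem sum_lin_sq_eq (n : ℕ) : ∑ i ∈ Finset.range n, ((n : ℝ) - i) ^ 2 = (n : ℝ) * (n + 1) * (2 * n + 1) / 6 := by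
  induction n with
  | zero => simp
  | succ n ih =>
    rw [Finset.sum_range_succ]
    have e : ∑ i ∈ Finset.range n, (((n + 1 : ℕ) : ℝ) - i) ^ 2 =
        ∑ i ∈ Finset.range n, (((n : ℝ) - i) ^ 2 + (2 * ((n : ℝ) - i) + 1)) :=
      Finset.sum_congr rfl fun i _ => by push_cast; ring
    rw [e, Finset.sum_add_distrib, ih, Finset.sum_add_distrib, Finset.sum_const, Finset.card_range, nsmul_eq_mul,
      ← Finset.mul_sum, sum_lin_eq]
    push_cast; ring

/-- `Σ_{i<n} (2i+1)(n − i) = n(n+1)(2n+1)/6`. [g99] -/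
theorem sum_odd_lin_eq (n : ℕ) :
    ∑ i ∈ Finset.range n, (2 * (i : ℝ) + 1) * ((n : ℝ) - i) = (n : ℝ) * (n + 1) * (2 * n + 1) / 6 := by
  induction n with
  | zero => simp
  | succ n ih =>
    rw [Finset.sum_range_succ]
    have e : ∑ i ∈ Finset.range n, (2 * (i : ℝ) + 1) * (((n + 1 : ℕ) : ℝ) - i) =
        ∑ i ∈ Finset.range n, ((2 * (i : ℝ) + 1) * ((n : ℝ) - i) + (2 * (i : ℝ) + 1)) :=
      Finset.sum_congr rfl fun i _ => by push_cast; ring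
    rw [e, Finset.sum_add_distrib, ih, Literature.Probability.Percolation.sum_range_two_mul_add_one]
    push_cast; ring

/-- the sum over positions `i < n` of a product of two range factors: `n(2n−1)(2n+1)/3` if both coordinates have stopped, `n(n+1)(2n+1)/6`
otherwise. [g99] -/
theorem sum_bfac_mul (n : ℕ) (t u : ℤ) :
    ∑ i ∈ Finset.range n, bfac n t i * bfac n u i =
      if t = 0 then (if u = 0 then (n : ℝ) * (2 * n - 1) * (2 * n + 1) / 3 else (n : ℝ) * (n + 1) * (2 * n + 1) / 6)
      else (if u = 0 then (n : ℝ) * (n + 1) * (2 * n + 1) / 6 else (n : ℝ) * (n + 1) * (2 * n + 1) / 6) := by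
  unfold bfac
  split_ifs with ht hu hu
  · rw [← sum_odd_sq_eq]; exact Finset.sum_congr rfl fun i _ => by ring
  · rw [← sum_odd_lin_eq]
  · rw [← sum_odd_lin_eq]; exact Finset.sum_congr rfl fun i _ => by ring
  · rw [← sum_lin_sq_eq]; exact Finset.sum_congr rfl fun i _ => by ring

/-! ### §5 The typed count and the typed remainder lemma -/

/-- ★ **TYPED KING COUNT**: the fibre of the king step type over any `s` inside `shell n × [0, n)` has at most `2n(n+1)(2n+1)/3` elements. [g99] -/
theorem king_typed_count (n : ℕ) (s : Cell 2 × ℤ) :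
    ((((shell n ×ˢ Finset.range n).filter (fun p => kstep p.1 p.2 = s)).card : ℕ) : ℝ) ≤ 2 * (n : ℝ) * (n + 1) * (2 * n + 1) / 3 := by
  classical
  set T := (shell n ×ˢ Finset.range n).filter (fun p => kstep p.1 p.2 = s) with hT
  have hsub : T ⊆ (Finset.range n).biUnion (fun i => (A0 n s i ∪ A1 n s i ∪ A2 n s i) ×ˢ {i}) := by
    intro p hp
    rw [hT, Finset.mem_filter, Finset.mem_product, Finset.mem_range] at hp
    rw [Finset.mem_biUnion]
    refine ⟨p.2, Finset.mem_range.mpr hp.1.2, Finset.mem_product.mpr ⟨mem_cover_of_kstep_eq hp.1.1 hp.1.2 hp.2, ?_⟩⟩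
    exact Finset.mem_singleton_self _
  have h1 : (T.card : ℝ) ≤ ∑ i ∈ Finset.range n, ((A0 n s i ∪ A1 n s i ∪ A2 n s i).card : ℝ) := by
    have := (Finset.card_le_card hsub).trans Finset.card_biUnion_le
    simp only [Finset.card_product, Finset.card_singleton, mul_one] at this
    exact_mod_cast this
  have h2 : ∑ i ∈ Finset.range n, ((A0 n s i ∪ A1 n s i ∪ A2 n s i).card : ℝ) ≤
      ∑ i ∈ Finset.range n, ((if s.1 0 = 0 then 0 else bfac n (s.1 1) i * bfac n s.2 i) +
        (if s.1 1 = 0 then 0 else bfac n (s.1 0) i * bfac n s.2 i) + (if s.2 = 0 then 0 else bfac n (s.1 0) i * bfac n (s.1 1) i)) :=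
    Finset.sum_le_sum fun i hi => card_cover_le n s (Finset.mem_range.mp hi)
  refine h1.trans (h2.trans ?_)
  rw [Finset.sum_add_distrib, Finset.sum_add_distrib]
  have hn : (0 : ℝ) ≤ n := Nat.cast_nonneg n
  have hprod : (0 : ℝ) ≤ (n : ℝ) * (n + 1) * (2 * n + 1) := by positivity
  have hprod' : (0 : ℝ) ≤ (n : ℝ) * (2 * n + 1) := by positivity
  -- every term is `≤ U`, and `≤ W` as soon as one of its two factors moves
  have hU : ∀ t u : ℤ, ∑ i ∈ Finset.range n, bfac n t i * bfac n u i ≤ 2 * (n : ℝ) * (n + 1) * (2 * n + 1) / 3 := by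
    intro t u; rw [sum_bfac_mul]; split_ifs <;> nlinarith [hprod, hprod']
  have hWt : ∀ t u : ℤ, t ≠ 0 → ∑ i ∈ Finset.range n, bfac n t i * bfac n u i ≤ (n : ℝ) * (n + 1) * (2 * n + 1) / 6 := by
    intro t u ht; rw [sum_bfac_mul, if_neg ht]; split_ifs <;> exact le_refl _
  have hWu : ∀ t u : ℤ, u ≠ 0 → ∑ i ∈ Finset.range n, bfac n t i * bfac n u i ≤ (n : ℝ) * (n + 1) * (2 * n + 1) / 6 := by
    intro t u hu; rw [sum_bfac_mul]; simp only [if_neg hu]; split_ifs <;> exact le_refl _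
  by_cases h0 : s.1 0 = 0
  · by_cases h1' : s.1 1 = 0
    · by_cases h2' : s.2 = 0
      · simp only [h0, h1', h2', if_true, Finset.sum_const_zero, add_zero]; positivity
      · simp only [h0, h1', h2', if_true, if_false, Finset.sum_const_zero, zero_add]; exact hU _ _
    · by_cases h2' : s.2 = 0
      · simp only [h0, h1', h2', if_true, if_false, Finset.sum_const_zero, zero_add, add_zero]; exact hU _ _
      · simp only [h0, h1', h2', if_true, if_false, Finset.sum_const_zero, zero_add]
        linarith [hWu 0 s.2 h2', hWu 0 (s.1 1) h1']
  · by_cases h1' : s.1 1 = 0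
    · by_cases h2' : s.2 = 0
      · simp only [h0, h1', h2', if_true, if_false, Finset.sum_const_zero, add_zero]; exact hU _ _
      · simp only [h0, h1', h2', if_true, if_false, Finset.sum_const_zero, add_zero]
        linarith [hWu 0 s.2 h2', hWt (s.1 0) 0 h0]
    · by_cases h2' : s.2 = 0
      · simp only [h0, h1', h2', if_true, if_false, Finset.sum_const_zero, add_zero]
        linarith [hWt (s.1 1) 0 h1', hWt (s.1 0) 0 h0]
      · simp only [h0, h1', h2', if_false]
        linarith [hWt (s.1 1) s.2 h1', hWt (s.1 0) s.2 h0, hWt (s.1 0) (s.1 1) h0]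

/-- ★ **TYPED KING MULTIPLICITY**: at most `2n(n+1)(2n+1)/3` pairs of king length `n` of any finite family are routed through a fixed pair. [g99] -/
theorem king_multiplicity_typed (y : (Cell 2 × ℤ) × (Cell 2 × ℤ)) (n : ℕ) (Y : Finset ((Cell 2 × ℤ) × (Cell 2 × ℤ)))
    (hY : ∀ x ∈ Y, kingN x = n ∧ ∃ i < kingN x, piece kingZ x i = y) :
    (Y.card : ℝ) ≤ 2 * (n : ℝ) * (n + 1) * (2 * n + 1) / 3 := by
  classical
  have h := card_routing_le_typed (z := kingZ) (n := n) (y := y) ⊤ (fun x t _ i => kingZ_add x t i) (shell n) Y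
    (fun _ _ _ _ => AddSubgroup.mem_top _) kstep (fun x _ i => kingZ_succ_sub_eq_kstep x i) fun x hx => by
    obtain ⟨hn, i, hi, hpi⟩ := hY x hx
    exact ⟨sub_mem_shell_of_kingN_eq hn, i, hn ▸ hi, hpi⟩
  exact (show (Y.card : ℝ) ≤ _ by exact_mod_cast h).trans (king_typed_count n (y.2 - y.1))

/-- ★★ **THE TYPED REMAINDER LEMMA FOR KING PATHS**: as `schemeDominatedOnP_remainder_king` with the multiplicity `M n = 2n(n+1)(2n+1)/3`. [g99] -/
theorem schemeDominatedOnP_remainder_king_typed {c₀ ϱ ℓ₀ α D θ : ℝ} (hα : 0 < α) (hc : 0 < c₀) {a b : E3} {w : ℤ → E3}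
    (hw : IsLayeredCrystal c₀ a b w) (hlip : ∀ m : ℤ, ‖w (m + 1) - w m‖ ≤ ℓ₀) (hϱ : ‖a‖ + ‖b‖ + ℓ₀ ≤ ϱ) (hϱ0 : 0 < ϱ) (hD : 0 < D)
    {nD : ℕ} (hnD : (nD : ℝ) - 1 ≤ D / ϱ)
    (hθ : ∀ N : ℕ, ∑ n ∈ Finset.Ico nD N, (2 * (n : ℝ) * (n + 1) * (2 * n + 1) / 3) * (7 * (n : ℝ) / max D (c₀ * n) ^ 8) ≤ θ) :
    SchemeDominatedOnP ϱ α a b w kingN kingZ (fun x => D < ‖bondVec a b w x‖) (fun _ => (1 + α) * θ) (fun _ => (1 + α⁻¹) * θ) := by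
  have hP := isPathSystem_king hc hw hlip hϱ
  refine schemeDominatedOnP_remainder (g := fun n => 7 * (n : ℝ) / max D (c₀ * n) ^ 8) (M := fun n => 2 * (n : ℝ) * (n + 1) * (2 * n + 1) / 3)
    hα (fun x _ i j hi hj h => king_simple x hi hj h) (fun x hx hDx => ?_) (fun x _ hDx => king_coef_le hc.le hw hD hDx)
    (fun n => div_nonneg (by positivity) (pow_nonneg (hD.le.trans (le_max_left _ _)) 8))
    (fun y n Y hY => king_multiplicity_typed y n Y fun x hx => ⟨(hY x hx).2.2.1, (hY x hx).2.2.2⟩) hθ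
  have h1 := lt_np_of_pathSystem hϱ0 hP hx hDx
  have h2 : (nD : ℝ) < (kingN x : ℝ) + 1 := by linarith
  have h3 : nD < kingN x + 1 := by exact_mod_cast h2
  omega

end Summit.AtomisticToContinuum.Crystallization.Theorems.ChartedZeroExcessLayeredLatticeLiouville
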